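import Summits.KontsevichZagierPeriods.Zeta5Search.Barrier.ConeGammaCuspPeriodFarkasSparse

/-!
# ζ(5) search — BARRIER: EXTENSION INDEPENDENCE — every threshold value, chamber weight and certificate of the cusp chain is the same for every admissible pattern data

HONEST FRAMING (cell `pub-zeta5`): systematic search; no irrationality claim unless kernel-certified. MODEL objects
under Brown–Zudilin's (28)+(30) accounting ([BZ22] = arXiv:2210.03391; (28) observed, not proved); nothing here is a
statement about `ζ(5)`, any `γ` of record, the cone's supremum (C2 OPEN) or the value / sign of the cusp slope or of a
chamber weight at a named direction (DATA of the cell); no certificate instance is asserted; S-E stays CONJECTURED;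
records in print UNMOVED. Prover P2 g34, file (5) (theorems only) — P2 g33's successor menu (a) «extension independence
in the kernel».

THE POINT. P2 g29–g32 carry the junction pattern functions as HYPOTHESES (`hf`: `f m` agrees with the saving on the
realisable patterns near `b_m`, on the finset `M m ⊇` members; `hF`: `F(A) = Σ_m f m (A ∩ M m)`), P2 g33 made one
admissible choice canonical (`patternN`). This file proves that NOTHING in the chain ever depended on the choice:
* `junction_threshold_eq_of_agreement` — two admissible junction data `(M, f)`, `(M', f')` at the same junction give the
  same value on every THRESHOLD SET `{l : −r_l(δ) ≤ x}`, `|x| ≤ W(δ)` (both are the saving at one point of the local line,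
  P2 g30's `torusN_line_eq_pattern`);
* **`period_threshold_eq_of_agreement`** — hence two admissible period pattern functions `F`, `F'` AGREE ON EVERY THRESHOLD
  SET of every displacement;
* `exists_threshold_eq_prefix_le` / `exists_threshold_eq_prefix_lt` — the two prefix sets `P≤(k)`, `P<(k)` of a generic
  reference are threshold sets (P2 g31's construction in `junction_greedy_weight_bounds`, at `M = univ`);
* **`chamber_weight_eq_of_agreement`** — so the CHAMBER WEIGHTS `W_k(δ₀) = F(P≤(k)) − F(P<(k))` are the same for `F` and
  `F'`, hence (`chamber_functional_eq_of_agreement`) the chamber functionals, their gradients, and with them every hull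
  certificate (files (1)–(2)) and every chamber Farkas certificate (files (3)–(4));
* **`chamber_weight_eq_canonical`** — in particular every admissible `F` has the chamber weights of P2 g33's CANONICAL
  `F = Σ_m patternN a b_m`: every statement of P2 g29–g34 about `W`, `G`, the gauges' main term or a certificate was a
  statement about one object.
NOT here: any value at a named direction; `γ`, C2, S-E, `ζ(5)`.
-/

noncomputable section

open Set MeasureTheory Finset
open scoped Topology

namespace Summit.KontsevichZagierPeriods.Zeta5Search.Barrier.ConeGamma

/-! ### Threshold sets: two admissible pattern data agree -/

/-- **An admissible scale for the local line of `δ`**: some `η > 0` has `η·K(δ) < 1` and `η·K(δ) < wallDist a T`. -/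
theorem exists_line_scale {a : Dir} (hpos : ∀ k, 0 < h28 a k) (T : ℝ) (δ : Fin 8 → ℝ) :
    ∃ η : ℝ, 0 < η ∧ η * clusterBound a δ < 1 ∧ η * clusterBound a δ < wallDist a T := by
  have hK := clusterBound_pos hpos δ
  have hd := wallDist_pos a T
  refine ⟨min 1 (wallDist a T) / (2 * clusterBound a δ), div_pos (lt_min one_pos hd) (by positivity), ?_, ?_⟩
  · have e : min 1 (wallDist a T) / (2 * clusterBound a δ) * clusterBound a δ = min 1 (wallDist a T) / 2 := by
      field_simp
    rw [e]; linarith [min_le_left (1 : ℝ) (wallDist a T)]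
  · have e : min 1 (wallDist a T) / (2 * clusterBound a δ) * clusterBound a δ = min 1 (wallDist a T) / 2 := by
      field_simp
    rw [e]; linarith [min_le_right (1 : ℝ) (wallDist a T)]

/-- **TWO ADMISSIBLE JUNCTION DATA AGREE ON EVERY THRESHOLD SET.** At a junction `b` (all forms of `a` positive), if the
saving near `θ_b` factors through `f` on the finset `M` AND through `f'` on `M'`, then for every displacement `δ` and every
`|x| ≤ W(δ)`: `f (M ∩ {l : −r_l(δ) ≤ x}) = f' (M' ∩ {l : −r_l(δ) ≤ x})` — both are the saving at one point of the local line. -/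
theorem junction_threshold_eq_of_agreement {a : Dir} (hpos : ∀ k, 0 < h28 a k) {T b : ℝ}
    {M M' : Finset (Fin 28)} {f f' : Finset (Fin 28) → ℝ}
    (hf : ∀ Δ : Fin 8 → ℝ, (∀ k, |phiForm Δ k| < 1) → (∀ k, |phiForm Δ k| < wallDist a T) →
      (torusN (b • sParam a + Δ) : ℝ) = f (M.filter fun k => 0 ≤ phiForm Δ k))
    (hf' : ∀ Δ : Fin 8 → ℝ, (∀ k, |phiForm Δ k| < 1) → (∀ k, |phiForm Δ k| < wallDist a T) →
      (torusN (b • sParam a + Δ) : ℝ) = f' (M'.filter fun k => 0 ≤ phiForm Δ k))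
    (δ : Fin 8 → ℝ) {x : ℝ} (hx : |x| ≤ clusterWidth a δ) :
    f (M.filter fun l => -(phiForm δ l / h28 a l) ≤ x) = f' (M'.filter fun l => -(phiForm δ l / h28 a l) ≤ x) := by
  obtain ⟨η, hη, h1, h2⟩ := exists_line_scale hpos T δ
  rw [← torusN_line_eq_pattern hpos hf δ hη h1 h2 hx, ← torusN_line_eq_pattern hpos hf' δ hη h1 h2 hx]

/-- **TWO ADMISSIBLE PERIOD PATTERN FUNCTIONS AGREE ON EVERY THRESHOLD SET.** All forms of `a` positive; `(M, f, F)` and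
`(M', f', F')` two admissible data of the cusp chain (`hf`/`hF` and `hf'`/`hF'`). Then for every displacement `δ` and every
`|x| ≤ W(δ)`: `F {l : −r_l(δ) ≤ x} = F' {l : −r_l(δ) ≤ x}` — the values the Lovász formula, the chamber weights and every
certificate of the chain are made of never depended on the extension. -/
theorem period_threshold_eq_of_agreement {a : Dir} (hpos : ∀ k, 0 < h28 a k) {T : ℝ}
    {M M' : ℕ → Finset (Fin 28)} {f f' : ℕ → Finset (Fin 28) → ℝ}
    (hf : ∀ m, m + 1 < (bkpts a T).card → ∀ Δ : Fin 8 → ℝ, (∀ k, |phiForm Δ k| < 1) →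
      (∀ k, |phiForm Δ k| < wallDist a T) →
        (torusN (bkpt a T m • sParam a + Δ) : ℝ) = f m ((M m).filter fun k => 0 ≤ phiForm Δ k))
    (hf' : ∀ m, m + 1 < (bkpts a T).card → ∀ Δ : Fin 8 → ℝ, (∀ k, |phiForm Δ k| < 1) →
      (∀ k, |phiForm Δ k| < wallDist a T) →
        (torusN (bkpt a T m • sParam a + Δ) : ℝ) = f' m ((M' m).filter fun k => 0 ≤ phiForm Δ k))
    {F F' : Finset (Fin 28) → ℝ} (hF : ∀ A, F A = ∑ m ∈ Finset.range ((bkpts a T).card - 1), f m (A ∩ M m))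
    (hF' : ∀ A, F' A = ∑ m ∈ Finset.range ((bkpts a T).card - 1), f' m (A ∩ M' m))
    (δ : Fin 8 → ℝ) {x : ℝ} (hx : |x| ≤ clusterWidth a δ) :
    F (Finset.univ.filter fun l => -(phiForm δ l / h28 a l) ≤ x) =
      F' (Finset.univ.filter fun l => -(phiForm δ l / h28 a l) ≤ x) := by
  rw [hF, hF']
  refine Finset.sum_congr rfl fun m hm => ?_
  have hm' : m + 1 < (bkpts a T).card := by have := Finset.mem_range.mp hm; omega
  rw [univ_filter_inter_eq, univ_filter_inter_eq]
  exact junction_threshold_eq_of_agreement hpos (hf m hm') (hf' m hm') δ hx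

/-! ### The prefix sets of a generic reference are threshold sets -/

/-- **`P≤(k)` is a threshold set**: `{l : ρ_k ≤ ρ_l} = {l : −ρ_l ≤ −ρ_k}` with `|−ρ_k| ≤ W(δ₀)`. -/
theorem exists_threshold_eq_prefix_le {a : Dir} (hpos : ∀ k, 0 < h28 a k) (δ₀ : Fin 8 → ℝ) (k : Fin 28) :
    ∃ x : ℝ, |x| ≤ clusterWidth a δ₀ ∧
      (Finset.univ.filter fun l => -(phiForm δ₀ l / h28 a l) ≤ x) =
        Finset.univ.filter fun l => phiForm δ₀ k / h28 a k ≤ phiForm δ₀ l / h28 a l := by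
  refine ⟨-(phiForm δ₀ k / h28 a k), ?_, Finset.filter_congr fun l _ => neg_le_neg_iff⟩
  rw [abs_neg]
  exact (abs_flip_lt_clusterWidth hpos δ₀ k).le

/-- **`P<(k)` is a threshold set** for a GENERIC reference: `{l : ρ_k < ρ_l} = {l : −ρ_l ≤ −ρ_k − ε}` for the half-gap
`ε` below the distances of `ρ_k` to the other 27 rates and to the window edge (P2 g31's construction). -/
theorem exists_threshold_eq_prefix_lt {a : Dir} (hpos : ∀ k, 0 < h28 a k) {δ₀ : Fin 8 → ℝ}
    (hgen : ∀ k l : Fin 28, k ≠ l → phiForm δ₀ k / h28 a k ≠ phiForm δ₀ l / h28 a l) (k : Fin 28) :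
    ∃ x : ℝ, |x| ≤ clusterWidth a δ₀ ∧
      (Finset.univ.filter fun l => -(phiForm δ₀ l / h28 a l) ≤ x) =
        Finset.univ.filter fun l => phiForm δ₀ k / h28 a k < phiForm δ₀ l / h28 a l := by
  classical
  obtain ⟨ρ, hρ⟩ : ∃ ρ : Fin 28 → ℝ, ∀ l, ρ l = phiForm δ₀ l / h28 a l := ⟨_, fun _ => rfl⟩
  simp only [← hρ]
  have hgenρ : ∀ l, l ≠ k → ρ l ≠ ρ k := fun l hl => by rw [hρ, hρ]; exact hgen l k hl
  set W := clusterWidth a δ₀ with hW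
  have hρW : |ρ k| < W := by rw [hρ]; exact abs_flip_lt_clusterWidth hpos δ₀ k
  let V : Finset ℝ := insert (W - |ρ k|) ((Finset.univ.erase k).image fun l => |ρ l - ρ k|)
  have hVne : V.Nonempty := ⟨_, Finset.mem_insert_self _ _⟩
  have hVpos : ∀ v ∈ V, 0 < v := fun v hv => by
    rcases Finset.mem_insert.mp hv with rfl | hv
    · linarith
    · obtain ⟨l, hl, rfl⟩ := Finset.mem_image.mp hv
      exact abs_pos.mpr (sub_ne_zero.mpr (hgenρ l (Finset.ne_of_mem_erase hl)))
  set ε : ℝ := V.min' hVne / 2 with hεdef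
  have hmin : 0 < V.min' hVne := hVpos _ (Finset.min'_mem V hVne)
  have hε : 0 < ε := by rw [hεdef]; linarith
  have hεW : 2 * ε ≤ W - |ρ k| := by
    rw [hεdef]; have := Finset.min'_le V _ (Finset.mem_insert_self _ _); linarith
  have hεl : ∀ l, l ≠ k → 2 * ε ≤ |ρ l - ρ k| := fun l hl => by
    rw [hεdef]
    have := Finset.min'_le V _ (Finset.mem_insert_of_mem
      (Finset.mem_image.mpr ⟨l, Finset.mem_erase.mpr ⟨hl, Finset.mem_univ _⟩, rfl⟩))
    linarith
  refine ⟨-ρ k - ε, ?_, Finset.filter_congr fun l _ => ?_⟩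
  · rw [abs_le]; constructor <;> linarith [le_abs_self (ρ k), neg_abs_le (ρ k)]
  · by_cases hlk : l = k
    · subst hlk; constructor <;> intro <;> linarith
    · have hg := hεl l hlk
      constructor
      · intro h; linarith
      · intro h
        rw [abs_of_pos (sub_pos.mpr h)] at hg
        linarith

/-! ### Chamber weights, chamber functionals and certificates are extension-free -/

/-- **THE CHAMBER WEIGHTS DO NOT DEPEND ON THE EXTENSION.** All forms of `a` positive; `(M, f, F)` and `(M', f', F')` two
admissible data; `δ₀` a generic reference. Then `F(P≤(k)) − F(P<(k)) = F'(P≤(k)) − F'(P<(k))` for every form `k`. -/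
theorem chamber_weight_eq_of_agreement {a : Dir} (hpos : ∀ k, 0 < h28 a k) {T : ℝ}
    {M M' : ℕ → Finset (Fin 28)} {f f' : ℕ → Finset (Fin 28) → ℝ}
    (hf : ∀ m, m + 1 < (bkpts a T).card → ∀ Δ : Fin 8 → ℝ, (∀ k, |phiForm Δ k| < 1) →
      (∀ k, |phiForm Δ k| < wallDist a T) →
        (torusN (bkpt a T m • sParam a + Δ) : ℝ) = f m ((M m).filter fun k => 0 ≤ phiForm Δ k))
    (hf' : ∀ m, m + 1 < (bkpts a T).card → ∀ Δ : Fin 8 → ℝ, (∀ k, |phiForm Δ k| < 1) →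
      (∀ k, |phiForm Δ k| < wallDist a T) →
        (torusN (bkpt a T m • sParam a + Δ) : ℝ) = f' m ((M' m).filter fun k => 0 ≤ phiForm Δ k))
    {F F' : Finset (Fin 28) → ℝ} (hF : ∀ A, F A = ∑ m ∈ Finset.range ((bkpts a T).card - 1), f m (A ∩ M m))
    (hF' : ∀ A, F' A = ∑ m ∈ Finset.range ((bkpts a T).card - 1), f' m (A ∩ M' m))
    {δ₀ : Fin 8 → ℝ} (hgen : ∀ k l : Fin 28, k ≠ l → phiForm δ₀ k / h28 a k ≠ phiForm δ₀ l / h28 a l)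
    (k : Fin 28) :
    F (Finset.univ.filter fun l => phiForm δ₀ k / h28 a k ≤ phiForm δ₀ l / h28 a l) -
        F (Finset.univ.filter fun l => phiForm δ₀ k / h28 a k < phiForm δ₀ l / h28 a l) =
      F' (Finset.univ.filter fun l => phiForm δ₀ k / h28 a k ≤ phiForm δ₀ l / h28 a l) -
        F' (Finset.univ.filter fun l => phiForm δ₀ k / h28 a k < phiForm δ₀ l / h28 a l) := by
  obtain ⟨x, hx, hSx⟩ := exists_threshold_eq_prefix_le hpos δ₀ k
  obtain ⟨x', hx', hSx'⟩ := exists_threshold_eq_prefix_lt hpos hgen k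
  rw [← hSx, ← hSx', period_threshold_eq_of_agreement hpos hf hf' hF hF' δ₀ hx,
    period_threshold_eq_of_agreement hpos hf hf' hF hF' δ₀ hx']

/-- **THE CHAMBER FUNCTIONALS DO NOT DEPEND ON THE EXTENSION**: `Σ_k W_k(δ₀)·r_k(δ) = Σ_k W'_k(δ₀)·r_k(δ)` for every `δ`;
so the chamber gradients, every hull certificate (files (1)–(2)) and every chamber Farkas certificate (files (3)–(4)) of
one admissible `F` are those of any other. -/
theorem chamber_functional_eq_of_agreement {a : Dir} (hpos : ∀ k, 0 < h28 a k) {T : ℝ}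
    {M M' : ℕ → Finset (Fin 28)} {f f' : ℕ → Finset (Fin 28) → ℝ}
    (hf : ∀ m, m + 1 < (bkpts a T).card → ∀ Δ : Fin 8 → ℝ, (∀ k, |phiForm Δ k| < 1) →
      (∀ k, |phiForm Δ k| < wallDist a T) →
        (torusN (bkpt a T m • sParam a + Δ) : ℝ) = f m ((M m).filter fun k => 0 ≤ phiForm Δ k))
    (hf' : ∀ m, m + 1 < (bkpts a T).card → ∀ Δ : Fin 8 → ℝ, (∀ k, |phiForm Δ k| < 1) →
      (∀ k, |phiForm Δ k| < wallDist a T) →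
        (torusN (bkpt a T m • sParam a + Δ) : ℝ) = f' m ((M' m).filter fun k => 0 ≤ phiForm Δ k))
    {F F' : Finset (Fin 28) → ℝ} (hF : ∀ A, F A = ∑ m ∈ Finset.range ((bkpts a T).card - 1), f m (A ∩ M m))
    (hF' : ∀ A, F' A = ∑ m ∈ Finset.range ((bkpts a T).card - 1), f' m (A ∩ M' m))
    {δ₀ : Fin 8 → ℝ} (hgen : ∀ k l : Fin 28, k ≠ l → phiForm δ₀ k / h28 a k ≠ phiForm δ₀ l / h28 a l)
    (δ : Fin 8 → ℝ) :
    ∑ k, (F (Finset.univ.filter fun l => phiForm δ₀ k / h28 a k ≤ phiForm δ₀ l / h28 a l) -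
          F (Finset.univ.filter fun l => phiForm δ₀ k / h28 a k < phiForm δ₀ l / h28 a l)) *
        (phiForm δ k / h28 a k) =
      ∑ k, (F' (Finset.univ.filter fun l => phiForm δ₀ k / h28 a k ≤ phiForm δ₀ l / h28 a l) -
          F' (Finset.univ.filter fun l => phiForm δ₀ k / h28 a k < phiForm δ₀ l / h28 a l)) *
        (phiForm δ k / h28 a k) :=
  Finset.sum_congr rfl fun k _ => by rw [chamber_weight_eq_of_agreement hpos hf hf' hF hF' hgen k]

open scoped Classical in
/-- **EVERY ADMISSIBLE PERIOD PATTERN FUNCTION HAS THE CANONICAL CHAMBER WEIGHTS.** All forms of `a` positive; `(M, f, F)`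
any admissible data of the cusp chain; `F_c = Σ_m patternN a b_m` P2 g33's canonical period pattern function; `δ₀` generic.
Then `F(P≤(k)) − F(P<(k)) = F_c(P≤(k)) − F_c(P<(k))` for every `k` — the chamber weights of P2 g29–g32, stated with a
hypothetical extension, were the canonical ones all along. -/
theorem chamber_weight_eq_canonical {a : Dir} (hpos : ∀ k, 0 < h28 a k) {T : ℝ}
    {M : ℕ → Finset (Fin 28)} {f : ℕ → Finset (Fin 28) → ℝ}
    (hf : ∀ m, m + 1 < (bkpts a T).card → ∀ Δ : Fin 8 → ℝ, (∀ k, |phiForm Δ k| < 1) →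
      (∀ k, |phiForm Δ k| < wallDist a T) →
        (torusN (bkpt a T m • sParam a + Δ) : ℝ) = f m ((M m).filter fun k => 0 ≤ phiForm Δ k))
    {F : Finset (Fin 28) → ℝ} (hF : ∀ A, F A = ∑ m ∈ Finset.range ((bkpts a T).card - 1), f m (A ∩ M m))
    {Fc : Finset (Fin 28) → ℝ}
    (hFc : ∀ A, Fc A = ∑ m ∈ Finset.range ((bkpts a T).card - 1), ((patternN a (bkpt a T m) A : ℤ) : ℝ))
    {δ₀ : Fin 8 → ℝ} (hgen : ∀ k l : Fin 28, k ≠ l → phiForm δ₀ k / h28 a k ≠ phiForm δ₀ l / h28 a l)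
    (k : Fin 28) :
    F (Finset.univ.filter fun l => phiForm δ₀ k / h28 a k ≤ phiForm δ₀ l / h28 a l) -
        F (Finset.univ.filter fun l => phiForm δ₀ k / h28 a k < phiForm δ₀ l / h28 a l) =
      Fc (Finset.univ.filter fun l => phiForm δ₀ k / h28 a k ≤ phiForm δ₀ l / h28 a l) -
        Fc (Finset.univ.filter fun l => phiForm δ₀ k / h28 a k < phiForm δ₀ l / h28 a l) := by
  classical
  exact chamber_weight_eq_of_agreement hpos hf
    (M' := fun m => Finset.univ.filter fun k => ∃ z : ℤ, bkpt a T m * h28 a k = z)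
    (f' := fun m A => ((patternN a (bkpt a T m) A : ℤ) : ℝ)) (canonical_junction_agreement a T) hF
    (canonical_period_eq_sum_inter hFc) hgen k

end Summit.KontsevichZagierPeriods.Zeta5Search.Barrier.ConeGamma

end
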